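import Summits.ValiantsHypothesis.ValiantsHypothesis.Theorems.KPlusLogSqLawTropicalBToeplitzFootrule

/-!
# Route `KPlusLogSqLaw`, crux `TropicalB` — Toeplitz sector: preliminaries of the BIPARTITE DOUBLING LAW (quadratic-slope class)

HONEST FRAMING.  Helper toward the registered stubs `stub_tropThin` / `stub_tropFat` (crux `…Theses.KPlusLogSqLaw.TropicalB`, item
`stmt-ValiantsHypothesis-19771`; cell `pub-symmetroid`, seat `val-sym-trop-p4` (g22), 2026-08-29).  Second group of ingredients (after `…ToeplitzFootrule`)
of this seat's DOUBLING LAW «Φ_Q(2n) ≥ Φ_Q(n) + Φ_Q(n)′ − 1» for the quadratic-slope class of the cell's Conjecture Q / T (memo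
HOME/val-sym-trop-p4/g22/DOUBLING-g22.md §1, §5(b); kernel rows `…ToeplitzTwenty79`, `…ToeplitzThirtyTwo161`).  In the doubled instance the chain of
one half is paired with a FROZEN partner on the other half — the identity at very negative effective slope, the reversal at very positive effective slope
— and this works from the POINTWISE uniqueness that `Toeplitz.FixedSlopeInstanceBound` records only because, for the squared displacement
`X(σ) = Σ_b (σ b − b)²`, the two extreme optima are unique for a structural reason:
* `sq_displacement_sum_eq_zero_iff` — `X(σ) = 0 ↔ σ = 1` (so `X(σ) ≥ 1` off the identity: `one_le_sq_displacement_sum`);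
* `sq_displacement_sum_rev_sub` — the identity **`X(rev) − X(σ) = Σ_b (σ b + b − (m−1))²`**, hence `X(σ) < X(rev)` for `σ ≠ rev`
  (`sq_displacement_sum_lt_rev`): the reversal is the UNIQUE maximiser of the squared displacement [folklore; rearrangement inequality, here by one
  completed square];
* `sq_displacement_sum_strictMono_of_chain` — along ANY chain of unique optima at strictly increasing slopes (the hypothesis shape of
  `FixedSlopeInstanceBound m (·²) Φ`) the squared displacement is STRICTLY INCREASING (add the two strict optimality inequalities); consequently only the
  first member can be the identity and only the last the reversal (`eq_zero_of_chain_eq_one`, `eq_last_of_chain_eq_rev`) — the «no collision» fact that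
  lets the two frozen-partner phases of the doubling be concatenated.
Nothing here bounds `Φ_Toep`; nothing bears on `TropicalB` for general designs, `KPlusLogSqLaw`, `MatrixDescartes` or `VP ≠ VNP`.

References: folklore (rearrangement / completed square); this seat's memo for the law these lemmas serve.
-/

set_option linter.dupNamespace false
set_option autoImplicit false

namespace Summit.ValiantsHypothesis.ValiantsHypothesis.Theorems.KPlusLogSqLaw.Toeplitz

open scoped BigOperators
open Finset

section SqDisplacement

variable {m : ℕ}

/-- `X(σ) = Σ_b (σ b − b)² = 0` iff `σ` is the identity. [folklore] -/
theorem sq_displacement_sum_eq_zero_iff (σ : Equiv.Perm (Fin m)) :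
    ∑ b : Fin m, (((σ b : Fin m) : ℤ) - (b : ℤ)) ^ 2 = 0 ↔ σ = 1 := by
  constructor
  · intro h
    have h0 : ∀ b ∈ (univ : Finset (Fin m)), (((σ b : Fin m) : ℤ) - (b : ℤ)) ^ 2 = 0 :=
      (sum_eq_zero_iff_of_nonneg fun b _ => sq_nonneg _).mp h
    ext b
    have hb := h0 b (mem_univ b)
    have : ((σ b : Fin m) : ℤ) = (b : ℤ) := by
      have := pow_eq_zero_iff (n := 2) (by norm_num) |>.mp hb
      linarith
    exact_mod_cast this
  · rintro rfl
    simp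

/-- Off the identity the squared displacement is at least `1`. [folklore] -/
theorem one_le_sq_displacement_sum {σ : Equiv.Perm (Fin m)} (hσ : σ ≠ 1) :
    1 ≤ ∑ b : Fin m, (((σ b : Fin m) : ℤ) - (b : ℤ)) ^ 2 := by
  have hnn : 0 ≤ ∑ b : Fin m, (((σ b : Fin m) : ℤ) - (b : ℤ)) ^ 2 := sum_nonneg fun b _ => sq_nonneg _
  have hne : ∑ b : Fin m, (((σ b : Fin m) : ℤ) - (b : ℤ)) ^ 2 ≠ 0 :=
    fun h => hσ ((sq_displacement_sum_eq_zero_iff σ).mp h)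
  omega

/-- **The completed square**: `X(rev) − X(σ) = Σ_b (σ b + b − (m − 1))²`. [folklore] -/
theorem sq_displacement_sum_rev_sub (σ : Equiv.Perm (Fin m)) :
    ∑ b : Fin m, (((Fin.revPerm b : Fin m) : ℤ) - (b : ℤ)) ^ 2 - ∑ b : Fin m, (((σ b : Fin m) : ℤ) - (b : ℤ)) ^ 2 =
      ∑ b : Fin m, (((σ b : Fin m) : ℤ) + (b : ℤ) - ((m : ℤ) - 1)) ^ 2 := by
  -- `Σ (σ b)² = Σ b²` and `Σ σ b = Σ b`
  have hsq : ∑ b : Fin m, ((σ b : Fin m) : ℤ) ^ 2 = ∑ b : Fin m, ((b : Fin m) : ℤ) ^ 2 :=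
    Equiv.sum_comp σ (fun b : Fin m => ((b : ℤ)) ^ 2)
  have hlin : ∑ b : Fin m, ((σ b : Fin m) : ℤ) = ∑ b : Fin m, ((b : Fin m) : ℤ) :=
    Equiv.sum_comp σ (fun b : Fin m => (b : ℤ))
  have hrev : ∀ b : Fin m, ((Fin.revPerm b : Fin m) : ℤ) = (m : ℤ) - 1 - (b : ℤ) := by
    intro b
    have hb := b.isLt
    rw [Fin.revPerm_apply, Fin.val_rev]
    push_cast [Nat.cast_sub (show b.val + 1 ≤ m by omega)]
    ring
  have e1 : ∑ b : Fin m, (((Fin.revPerm b : Fin m) : ℤ) - (b : ℤ)) ^ 2 =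
      ∑ b : Fin m, (((m : ℤ) - 1) ^ 2 - 4 * ((m : ℤ) - 1) * (b : ℤ) + 4 * ((b : Fin m) : ℤ) ^ 2) :=
    sum_congr rfl fun b _ => by rw [hrev]; ring
  have e2 : ∑ b : Fin m, (((σ b : Fin m) : ℤ) - (b : ℤ)) ^ 2 =
      ∑ b : Fin m, ((σ b : Fin m) : ℤ) ^ 2 - 2 * ∑ b : Fin m, ((σ b : Fin m) : ℤ) * (b : ℤ) + ∑ b : Fin m, ((b : Fin m) : ℤ) ^ 2 := by
    rw [mul_sum, ← sum_sub_distrib, ← sum_add_distrib]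
    exact sum_congr rfl fun b _ => by ring
  have e3 : ∑ b : Fin m, (((σ b : Fin m) : ℤ) + (b : ℤ) - ((m : ℤ) - 1)) ^ 2 =
      ∑ b : Fin m, ((σ b : Fin m) : ℤ) ^ 2 + 2 * ∑ b : Fin m, ((σ b : Fin m) : ℤ) * (b : ℤ) + ∑ b : Fin m, ((b : Fin m) : ℤ) ^ 2
        - 2 * ((m : ℤ) - 1) * ∑ b : Fin m, ((σ b : Fin m) : ℤ) - 2 * ((m : ℤ) - 1) * ∑ b : Fin m, ((b : Fin m) : ℤ)
        + ∑ _b : Fin m, ((m : ℤ) - 1) ^ 2 := by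
    rw [mul_sum, mul_sum, mul_sum, ← sum_add_distrib, ← sum_add_distrib, ← sum_sub_distrib, ← sum_sub_distrib, ← sum_add_distrib]
    exact sum_congr rfl fun b _ => by ring
  have e4 : ∑ b : Fin m, (((m : ℤ) - 1) ^ 2 - 4 * ((m : ℤ) - 1) * (b : ℤ) + 4 * ((b : Fin m) : ℤ) ^ 2) =
      ∑ _b : Fin m, ((m : ℤ) - 1) ^ 2 - 4 * ((m : ℤ) - 1) * ∑ b : Fin m, ((b : Fin m) : ℤ) + 4 * ∑ b : Fin m, ((b : Fin m) : ℤ) ^ 2 := by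
    rw [mul_sum, mul_sum, ← sum_sub_distrib, ← sum_add_distrib]
  rw [e1, e2, e3, e4, hsq, hlin]
  ring

/-- **The reversal is the unique maximiser of the squared displacement**: `X(σ) < X(rev)` for `σ ≠ rev`. [folklore] -/
theorem sq_displacement_sum_lt_rev {σ : Equiv.Perm (Fin m)} (hσ : σ ≠ Fin.revPerm) :
    ∑ b : Fin m, (((σ b : Fin m) : ℤ) - (b : ℤ)) ^ 2 < ∑ b : Fin m, (((Fin.revPerm b : Fin m) : ℤ) - (b : ℤ)) ^ 2 := by
  have hid := sq_displacement_sum_rev_sub σ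
  have hnn : 0 ≤ ∑ b : Fin m, (((σ b : Fin m) : ℤ) + (b : ℤ) - ((m : ℤ) - 1)) ^ 2 := sum_nonneg fun b _ => sq_nonneg _
  have hne : ∑ b : Fin m, (((σ b : Fin m) : ℤ) + (b : ℤ) - ((m : ℤ) - 1)) ^ 2 ≠ 0 := by
    intro h
    have h0 : ∀ b ∈ (univ : Finset (Fin m)), (((σ b : Fin m) : ℤ) + (b : ℤ) - ((m : ℤ) - 1)) ^ 2 = 0 :=
      (sum_eq_zero_iff_of_nonneg fun b _ => sq_nonneg _).mp h
    apply hσ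
    ext b
    have hb := h0 b (mem_univ b)
    have h1 : ((σ b : Fin m) : ℤ) + (b : ℤ) - ((m : ℤ) - 1) = 0 := pow_eq_zero_iff (n := 2) (by norm_num) |>.mp hb
    have hb' := b.isLt
    rw [Fin.revPerm_apply, Fin.val_rev]
    omega
  omega

/-- Pointwise form used by the doubling law: `X(σ) + 1 ≤ X(rev)` for `σ ≠ rev`. -/
theorem sq_displacement_sum_succ_le_rev {σ : Equiv.Perm (Fin m)} (hσ : σ ≠ Fin.revPerm) :
    ∑ b : Fin m, (((σ b : Fin m) : ℤ) - (b : ℤ)) ^ 2 + 1 ≤ ∑ b : Fin m, (((Fin.revPerm b : Fin m) : ℤ) - (b : ℤ)) ^ 2 := by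
  have := sq_displacement_sum_lt_rev hσ
  omega

end SqDisplacement

section ChainMonotone

variable {m N : ℕ}

/-- **Along a chain of unique optima at strictly increasing slopes the squared displacement is strictly increasing** (quadratic-slope class:
`ψ δ = δ²`): add the strict optimality of `τ i` at `θ i` against `τ j` and of `τ j` at `θ j` against `τ i`. [folklore] -/
theorem sq_displacement_sum_strictMono_of_chain (α : ℤ → ℤ) (θ' : Fin (N + 1) → ℤ)
    (τ : Fin (N + 1) → Equiv.Perm (Fin m)) (hθ : StrictMono θ') (hinj : Function.Injective τ)
    (hopt : ∀ k (σ' : Equiv.Perm (Fin m)), σ' ≠ τ k →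
      ∑ b, (θ' k * (fun δ : ℤ => δ ^ 2) ((σ' b : ℤ) - (b : ℤ)) + α ((σ' b : ℤ) - (b : ℤ))) <
        ∑ b, (θ' k * (fun δ : ℤ => δ ^ 2) ((τ k b : ℤ) - (b : ℤ)) + α ((τ k b : ℤ) - (b : ℤ)))) :
    StrictMono fun k => ∑ b : Fin m, (((τ k b : Fin m) : ℤ) - (b : ℤ)) ^ 2 := by
  intro i j hij
  have hne : τ i ≠ τ j := fun h => (ne_of_lt hij) (hinj h)
  have h1 := hopt i (τ j) hne.symm
  have h2 := hopt j (τ i) hne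
  have hθij : θ' i < θ' j := hθ hij
  simp only [sum_add_distrib, ← mul_sum] at h1 h2
  dsimp only
  by_contra hcon
  push Not at hcon
  nlinarith [mul_le_mul_of_nonneg_left hcon (sub_nonneg.mpr hθij.le)]

/-- Only the FIRST member of such a chain can be the identity. -/
theorem eq_zero_of_chain_eq_one (α : ℤ → ℤ) (θ' : Fin (N + 1) → ℤ)
    (τ : Fin (N + 1) → Equiv.Perm (Fin m)) (hθ : StrictMono θ') (hinj : Function.Injective τ)
    (hopt : ∀ k (σ' : Equiv.Perm (Fin m)), σ' ≠ τ k →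
      ∑ b, (θ' k * (fun δ : ℤ => δ ^ 2) ((σ' b : ℤ) - (b : ℤ)) + α ((σ' b : ℤ) - (b : ℤ))) <
        ∑ b, (θ' k * (fun δ : ℤ => δ ^ 2) ((τ k b : ℤ) - (b : ℤ)) + α ((τ k b : ℤ) - (b : ℤ))))
    {j : Fin (N + 1)} (hj : τ j = 1) : j = 0 := by
  by_contra hj0
  have hlt : (0 : Fin (N + 1)) < j := Fin.pos_of_ne_zero hj0
  have hX := sq_displacement_sum_strictMono_of_chain α θ' τ hθ hinj hopt hlt
  have hXj : ∑ b : Fin m, (((τ j b : Fin m) : ℤ) - (b : ℤ)) ^ 2 = 0 := by rw [hj]; simp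
  have hnn : 0 ≤ ∑ b : Fin m, (((τ 0 b : Fin m) : ℤ) - (b : ℤ)) ^ 2 := sum_nonneg fun b _ => sq_nonneg _
  simp only at hX
  omega

/-- Only the LAST member of such a chain can be the reversal. -/
theorem eq_last_of_chain_eq_rev (α : ℤ → ℤ) (θ' : Fin (N + 1) → ℤ)
    (τ : Fin (N + 1) → Equiv.Perm (Fin m)) (hθ : StrictMono θ') (hinj : Function.Injective τ)
    (hopt : ∀ k (σ' : Equiv.Perm (Fin m)), σ' ≠ τ k →
      ∑ b, (θ' k * (fun δ : ℤ => δ ^ 2) ((σ' b : ℤ) - (b : ℤ)) + α ((σ' b : ℤ) - (b : ℤ))) <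
        ∑ b, (θ' k * (fun δ : ℤ => δ ^ 2) ((τ k b : ℤ) - (b : ℤ)) + α ((τ k b : ℤ) - (b : ℤ))))
    {i : Fin (N + 1)} (hi : τ i = Fin.revPerm) : i = Fin.last N := by
  by_contra hil
  have hlt : i < Fin.last N := lt_of_le_of_ne (Fin.le_last i) hil
  have hX := sq_displacement_sum_strictMono_of_chain α θ' τ hθ hinj hopt hlt
  simp only at hX
  rw [hi] at hX
  have hne : τ (Fin.last N) ≠ Fin.revPerm := by
    intro h; exact hil (hinj (hi.trans h.symm))
  have := sq_displacement_sum_lt_rev hne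
  omega

end ChainMonotone

end Summit.ValiantsHypothesis.ValiantsHypothesis.Theorems.KPlusLogSqLaw.Toeplitz
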